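import Literature.NumberTheory.Transcendental.CurvePeriodsEllipticIsogenyProofs
import Literature.NumberTheory.Transcendental.CurvePeriodsEllipticPathsHolds
import Literature.NumberTheory.Transcendental.CurvePeriodsEllipticCMLoopsProofs
import HarnessLib

/-!
# Periods of curve type on elliptic curves, XV: isogenous curves — UNCONDITIONAL

Companion of `Literature/NumberTheory/Transcendental/CurvePeriods.lean` (Huber–Wüstholz 2022,
Thm. 13.3 (2) = Kontsevich's period conjecture for periods of curve type, rendered on explicit
period symbols `(Z, ω, γ)` with the elementary relations (R1)–(R5); general statement: the named
fact `HuberWustholzCurvePeriods`), of `CurvePeriodsEllipticIsogenyProofs.lean` (an isogeny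
`[α] : E_L → E_M` as functoriality) and of `CurvePeriodsEllipticPathsHolds.lean` (the theorem for
ONE non-CM elliptic curve with arbitrary paths, unconditional). Several curves: the theorem is
proved for all elliptic curves ISOGENOUS to a fixed non-CM curve `E_M` at once —

* `Ell.Isog.exists_transfer_symbol` — **transfer along an isogeny**: every symbol `(E_L, ω, γ)`
  is, modulo the elementary relations, a `ℚ̄`-combination of `(E_M, θ₀, φ_M∘(αg))`,
  `(E_M, θ₁, φ_M∘(αg))` and `𝟙` for a suitable `C¹` lift `g` (de Rham reduction, translation
  to a generic algebraic base point, a lift avoiding `α⁻¹Λ_M`, and the isogeny relations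
  `Reps.span_cmul_theta0/1` solved for the `E_L`-symbols);
* `huberWustholzCurvePeriods_of_isogenousEllipticLoops` — closed paths on curves isogenous to
  ANY `E_M` (CM allowed), with closed paths on `𝔾ₘ` and `𝔸¹` (through
  `huberWustholzCurvePeriods_ellipticLoops_all`);
* `huberWustholzCurvePeriods_of_isogenousEllipticPaths` — **Theorem 13.3 (2) for the curves
  `E_L` isogenous to a non-CM `E_M` (any number of them), `E_M`, the punctured lines `Z_a`,
  `𝔾ₘ` and `𝔸¹`, all with ARBITRARY `C¹` paths — PROVED** (`span_of_transfer_finsupp`, then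
  `huberWustholzCurvePeriods_ellipticPaths_puncturedLine` for `M`).

The relations between the periods of isogenous curves (e.g. `ω₁′ = α(aω₁ + bω₂)`) are thus
INDUCED BY FUNCTORIALITY, as Theorem 13.3 (2) asserts; the transcendence input is the tree's
analytic subgroup theorem for `𝔾ₐ × 𝔾ₘ^ι × (E_M♮)^κ` (`analyticSubgroupTheorem_GaGmE_holds`).

What is NOT here: pairwise NON-isogenous curves (the dimension formula, Thm. 15.3, needs the
analytic subgroup theorem for products of non-isogenous curves — the named fact
`HuberWustholzTwoCurvePeriods` is its closed-path shadow), CM curves with open paths, genus `≥ 2`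
— the general named fact `HuberWustholzCurvePeriods`.

## References

* A. Huber, G. Wüstholz, *Transcendence and Linear Relations of 1-Periods*, Cambridge Tracts in
  Mathematics 227, CUP 2022 [HuberWustholz2022]: Thm. 13.3 (2) (p. 121 of the held text), §13.1
  (B) (p. 120), §13.2 (pp. 122–125), Ch. 15.
* J. H. Silverman, *The Arithmetic of Elliptic Curves*, 2nd ed., GTM 106, 2009, III.4, VI.4.1.
  [SilvermanAEC2009]
-/

noncomputable section

open scoped BigOperators
open scoped PeriodPair
open scoped Topology
open MvPolynomial Set Complex Filter Metric

namespace Literature.NumberTheory.Transcendental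

namespace CurvePeriods

set_option quotPrecheck false in
/-- Membership in the `ℚ̄`-span of the elementary relations, in the format of the conclusion of
`HuberWustholzCurvePeriods`. -/
local notation "InSpan" c:max => ∃ (k : ℕ) (ρ : Fin k → (PeriodSymbol →₀ ℂ)) (a : Fin k → ℂ),
  (∀ l, IsElementaryRelation (ρ l)) ∧ (∀ l, IsAlgebraic ℚ (a l)) ∧ c = ∑ l, a l • ρ l

namespace Ell

namespace Isog

/-! ### Transfer of a symbol along an isogeny -/

/-- **Every symbol on `E_L` is, modulo the relations, a `ℚ̄`-combination of two symbols on an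
isogenous curve `E_M` and of `𝟙`.** Let `[α] : E_L → E_M` be an isogeny with kernel data `S`
(`Reps L M α S`), all invariants algebraic. For a symbol `(E_L, ω, γ)`: de Rham reduction and a lift
`D : z₀ ↝ z₁` (`Ell.exists_liftData_rel`), translation to a generic algebraic base point `t₀`
(`Ell.LiftData.span_translate_theta0/1`) along a lift `g : t₀ ↝ t₀ + (z₁ − z₀)` avoiding
`α⁻¹Λ_M` (`Ell.exists_path_avoiding`), and the isogeny relations (`Reps.span_cmul_theta0/1`,
solved for the `E_L`-symbols: `α ≠ 0`, `|S|/α ≠ 0`) express it through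
`(E_M, θ₀, φ_M∘(αg))`, `(E_M, θ₁, φ_M∘(αg))` and `𝟙` with algebraic coefficients.
[cite: HuberWustholz2022, Thm. 13.3 (2) (p. 121), §13.1 (B) (p. 120), §13.2] -/
theorem exists_transfer_symbol {L M : PeriodPair} {α : ℂ} {S : Finset ℂ} (hR : Reps L M α S)
    (h₂ : IsAlgebraic ℚ L.g₂) (h₃ : IsAlgebraic ℚ L.g₃) (h₂' : IsAlgebraic ℚ M.g₂)
    (h₃' : IsAlgebraic ℚ M.g₃) (ω : Fin 2 → MvPolynomial (Fin 2) ℂ) (hω : ∀ k, HasAlgCoeffs (ω k))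
    (γ : CurvePath (curve L)) :
    ∃ V : PeriodSymbol →₀ ℂ, (∀ t, IsAlgebraic ℚ (V t)) ∧
      InSpan (Finsupp.single (⟨curve L, smooth L h₂ h₃, ω, hω, γ⟩ : PeriodSymbol) (1 : ℂ) - V) ∧
      ∀ t ∈ V.support, (t.Z = curve M ∧ (γ.toFun 1 = γ.toFun 0 → t.γ.toFun 1 = t.γ.toFun 0)) ∨
        t.Z = CurveData.affineLine := by
  classical
  have hα0 := hR.ne_zero
  -- Step 1: de Rham reduction and a lift (of a closed path: with displacement in `Λ_L`)
  obtain ⟨z₀, z₁, Dl, a, b, e, hmem, ha, hb, he, hrel⟩ : ∃ (z₀ z₁ : ℂ) (D : LiftData L z₀ z₁)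
      (a b e : ℂ), (γ.toFun 1 = γ.toFun 0 → z₁ - z₀ ∈ L.lattice) ∧
      IsAlgebraic ℚ a ∧ IsAlgebraic ℚ b ∧ IsAlgebraic ℚ e ∧
      InSpan (Finsupp.single (⟨curve L, smooth L h₂ h₃, ω, hω, γ⟩ : PeriodSymbol) (1 : ℂ) -
        a • D.sym h₂ h₃ (theta0 L) (hasAlgCoeffs_theta0 L h₂ h₃) -
        b • D.sym h₂ h₃ (theta1 L) (hasAlgCoeffs_theta1 L h₂ h₃) -
        e • Finsupp.single PeriodSymbol.unit (1 : ℂ)) := by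
    by_cases hcl : γ.toFun 1 = γ.toFun 0
    · obtain ⟨z₀, z₁, D, a, b, e, hmem, ha, hb, he, hrel⟩ :=
        exists_liftData_rel_closed h₂ h₃ ω hω γ hcl
      exact ⟨z₀, z₁, D, a, b, e, fun _ => hmem, ha, hb, he, hrel⟩
    · obtain ⟨z₀, z₁, D, a, b, e, ha, hb, he, hrel⟩ := exists_liftData_rel h₂ h₃ ω hω γ
      exact ⟨z₀, z₁, D, a, b, e, fun h => (hcl h).elim, ha, hb, he, hrel⟩
  set w : ℂ := z₁ - z₀ with hw
  have hwA : AlgLog L w := (Dl.alg_stop.algLog).sub L h₂ Dl.alg_start.algLog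
  -- Step 2: a generic algebraic base point
  set B : Finset ℂ := ({z₀, 2 * z₀, z₀ - z₁, z₀ + z₁} : Finset ℂ) ∪ S ∪ S.image (fun c => c - w)
    with hB
  obtain ⟨t₀, ht₀, hgen⟩ := exists_generic_algPt L h₂ h₃ B
  have hz0 : t₀ - z₀ ∉ L.lattice := hgen _ (by simp [hB])
  have h2z0 : t₀ - 2 * z₀ ∉ L.lattice := hgen _ (by simp [hB])
  have hdiff : t₀ - (z₀ - z₁) ∉ L.lattice := hgen _ (by simp [hB])
  have hsum01 : t₀ - (z₀ + z₁) ∉ L.lattice := hgen _ (by simp [hB])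
  have hαt₀ : α * t₀ ∉ M.lattice := by
    intro h
    obtain ⟨c, hcS, hc⟩ := (hR.reps t₀).1 h
    exact hgen c (by simp [hB, hcS]) hc
  have hαt₀w : α * (t₀ + w) ∉ M.lattice := by
    intro h
    obtain ⟨c, hcS, hc⟩ := (hR.reps (t₀ + w)).1 h
    refine hgen (c - w) (by simp [hB, hcS]) ?_
    have e' : t₀ - (c - w) = t₀ + w - c := by ring
    rwa [e']
  have hws : IsAlgPt L (t₀ + w) := by
    refine (ht₀.algLog.add L h₂ hwA).isAlgPt ?_
    have e' : t₀ + w = t₀ - (z₀ - z₁) := by rw [hw]; ring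
    rw [e']; exact hdiff
  -- Step 3: a lift `g : t₀ ↝ t₀ + w` avoiding `α⁻¹Λ_M`
  set Sset : Set ℂ := {x | α * x ∈ M.lattice} with hSset
  have hfin : ∀ (p : ℂ) (R : ℝ), (Sset ∩ closedBall p R).Finite := by
    intro p R
    have e' : Sset = ((M.mulLeft α⁻¹ (inv_ne_zero hα0)).lattice : Set ℂ) := by
      ext x
      rw [hSset, Set.mem_setOf_eq, SetLike.mem_coe, PeriodPair.mem_mulLeft_inv_lattice hα0]
    rw [e']
    exact finite_lattice_inter_closedBall _ p R
  obtain ⟨g, hg, hg0, hg1, hgS⟩ := exists_path_avoiding hfin (a := t₀) (b := t₀ + w) hαt₀ hαt₀w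
  have hαg : ∀ t ∈ Icc (0 : ℝ) 1, α * g t ∉ M.lattice := fun t ht => hgS t ht
  have hΛg : ∀ t ∈ Icc (0 : ℝ) 1, g t ∉ L.lattice := fun t ht => hR.notMem_of_mul_notMem (hαg t ht)
  set Dtr : LiftData L t₀ (t₀ + w) := ⟨g, hg, hΛg, hg0, hg1, ht₀, hws⟩ with hDtr
  -- Step 4: translation by `v = t₀ − z₀`
  set v : ℂ := t₀ - z₀ with hv
  have hvalg : IsAlgPt L v := (ht₀.algLog.sub L h₂ Dl.alg_start.algLog).isAlgPt hz0
  have hne0 : ℘[L] z₀ ≠ ℘[L] v := by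
    refine (weierstrassP_ne_iff L Dl.alg_start.1 hvalg.1).2 ⟨?_, ?_⟩
    · have e' : z₀ + v = t₀ := by rw [hv]; ring
      rw [e']; exact ht₀.1
    · intro h
      apply h2z0
      have e' : t₀ - 2 * z₀ = -(z₀ - v) := by rw [hv]; ring
      rw [e']; exact neg_mem h
  have hne1 : ℘[L] z₁ ≠ ℘[L] v := by
    refine (weierstrassP_ne_iff L Dl.alg_stop.1 hvalg.1).2 ⟨?_, ?_⟩
    · have e' : z₁ + v = t₀ - (z₀ - z₁) := by rw [hv]; ring
      rw [e']; exact hdiff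
    · intro h
      apply hsum01
      have e' : t₀ - (z₀ + z₁) = -(z₁ - v) := by rw [hv]; ring
      rw [e']; exact neg_mem h
  have ea : t₀ = z₀ + v := by rw [hv]; ring
  have eb : t₀ + w = z₁ + v := by rw [hv, hw]; ring
  have rt0 := LiftData.span_translate_theta0 h₂ h₃ hvalg Dl (Dtr.cast ea eb) hne0 hne1
  have rt1 := LiftData.span_translate_theta1 h₂ h₃ hvalg Dl (Dtr.cast ea eb) hne0 hne1
  rw [LiftData.sym_cast] at rt0 rt1
  have hκ := isAlgebraic_translate_const L hvalg Dl.alg_start Dl.alg_stop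
  -- Step 5: the isogeny relations along `g`
  have hαt₀alg : IsAlgPt M (α * t₀) := hR.isAlgPt_mul h₂ h₃ ht₀ hαt₀
  have hαend : IsAlgPt M (α * (t₀ + w)) := hR.isAlgPt_mul h₂ h₃ hws hαt₀w
  have hg' : ContDiff ℝ 1 fun t => α * g t := contDiff_const.mul hg
  have h0' : IsAlgPt M (α * g 0) := by rw [hg0]; exact hαt₀alg
  have h1' : IsAlgPt M (α * g 1) := by rw [hg1]; exact hαend
  set σ₀ : PeriodSymbol := ⟨curve M, smooth M h₂' h₃', theta0 M, hasAlgCoeffs_theta0 M h₂' h₃',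
    liftPath M (fun t => α * g t) hg' hαg h0' h1'⟩ with hσ₀
  set σ₁ : PeriodSymbol := ⟨curve M, smooth M h₂' h₃', theta1 M, hasAlgCoeffs_theta1 M h₂' h₃',
    liftPath M (fun t => α * g t) hg' hαg h0' h1'⟩ with hσ₁
  have rc0 : InSpan (Finsupp.single σ₀ (1 : ℂ) -
      α • Dtr.sym h₂ h₃ (theta0 L) (hasAlgCoeffs_theta0 L h₂ h₃)) :=
    hR.span_cmul_theta0 h₂ h₃ h₂' h₃' hg hαg hΛg Dtr.alg0 Dtr.alg1 hg' h0' h1'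
  set Gd : ℂ := eval (psiC L S (g 1)) (GC L α S) - eval (psiC L S (g 0)) (GC L α S) with hGd
  have rc1 : InSpan (Finsupp.single σ₁ (1 : ℂ) -
      bC α S • Dtr.sym h₂ h₃ (theta1 L) (hasAlgCoeffs_theta1 L h₂ h₃) -
      aC L α S • Dtr.sym h₂ h₃ (theta0 L) (hasAlgCoeffs_theta0 L h₂ h₃) +
      Gd • Finsupp.single PeriodSymbol.unit (1 : ℂ)) :=
    hR.span_cmul_theta1 h₂ h₃ h₂' h₃' hg hαg hΛg Dtr.alg0 Dtr.alg1 hg' h0' h1'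
  have hGdalg : IsAlgebraic ℚ Gd := by
    rw [hGd, hg0, hg1]
    exact (isAlgebraic_eval_GC_of (hR.isAlgPt_reps h₂ h₃) hR.algebraic hws).sub
      (isAlgebraic_eval_GC_of (hR.isAlgPt_reps h₂ h₃) hR.algebraic ht₀)
  -- the coefficients
  have hb0 : bC α S ≠ 0 := by
    rw [bC]
    refine div_ne_zero ?_ hα0
    exact_mod_cast (Finset.card_pos.mpr ⟨0, hR.zero_mem⟩).ne'
  have hαinv : IsAlgebraic ℚ α⁻¹ := hR.algebraic.inv
  have hbC := isAlgebraic_bC_of (S := S) hR.algebraic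
  have hbinv : IsAlgebraic ℚ (bC α S)⁻¹ := hbC.inv
  have haC := isAlgebraic_aC_of (hR.isAlgPt_reps h₂ h₃) hR.algebraic
  set κ : ℂ := eval (psiT L v z₁) (rPolyT L v) - eval (psiT L v z₀) (rPolyT L v) with hκdef
  set A : ℂ := a * α⁻¹ - b * ((bC α S)⁻¹ * aC L α S * α⁻¹) with hA
  set Bc : ℂ := b * (bC α S)⁻¹ with hBc
  set E : ℂ := e + b * ((bC α S)⁻¹ * Gd) - b * κ with hE
  refine ⟨A • Finsupp.single σ₀ (1 : ℂ) + Bc • Finsupp.single σ₁ (1 : ℂ) +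
    E • Finsupp.single PeriodSymbol.unit (1 : ℂ), fun t => ?_, ?_, fun t ht => ?_⟩
  · simp only [Finsupp.add_apply, Finsupp.smul_apply, smul_eq_mul]
    refine (((((ha.mul hαinv).sub (hb.mul ((hbinv.mul haC).mul hαinv))).mul
      (isAlgebraic_single_one_apply _ _)).add
      ((hb.mul hbinv).mul (isAlgebraic_single_one_apply _ _))).add
      (((he.add (hb.mul (hbinv.mul hGdalg))).sub (hb.mul hκ)).mul
        (isAlgebraic_single_one_apply _ _)))
  · -- the combination
    obtain ⟨K, ρ, cf, hρ, hcf, hsum⟩ :=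
      span_sub (span_sub hrel
        (span_smul ha (span_add (span_smul hαinv rc0) rt0)))
        (span_smul hb (span_add (span_smul hbinv (span_sub rc1
          (span_smul haC (span_smul hαinv rc0)))) rt1))
    refine ⟨K, ρ, cf, hρ, hcf, ?_⟩
    rw [← hsum]
    simp only [smul_sub, smul_add, smul_smul]
    rw [show α⁻¹ * α = 1 from inv_mul_cancel₀ hα0,
      show (bC α S)⁻¹ * bC α S = 1 from inv_mul_cancel₀ hb0]
    module
  · -- closedness is preserved: `α(z₁ − z₀) ∈ Λ_M`
    have hclosed : γ.toFun 1 = γ.toFun 0 →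
        (liftPath M (fun t => α * g t) hg' hαg h0' h1').toFun 1 =
          (liftPath M (fun t => α * g t) hg' hαg h0' h1').toFun 0 := fun hcl => by
      rw [liftPath_toFun, liftPath_toFun, hg1, hg0, mul_add]
      exact phi_add_of_mem M (α * t₀) (hR.mul_mem _ (hmem hcl))
    rcases Finset.mem_union.1 (Finsupp.support_add ht) with h1 | h1
    · rcases Finset.mem_union.1 (Finsupp.support_add h1) with h2 | h2
      · have h3 := (Finsupp.mem_support_single _ _ _).1 (Finsupp.support_smul h2)
        exact Or.inl (by rw [h3.1]; exact ⟨rfl, hclosed⟩)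
      · have h3 := (Finsupp.mem_support_single _ _ _).1 (Finsupp.support_smul h2)
        exact Or.inl (by rw [h3.1]; exact ⟨rfl, hclosed⟩)
    · have h3 := (Finsupp.mem_support_single _ _ _).1 (Finsupp.support_smul h1)
      exact Or.inr (by rw [h3.1]; rfl)

end Isog

end Ell

/-! ### The theorem: several pairwise isogenous non-CM elliptic curves, arbitrary paths -/

section Main

-- The punctured line `Z_a = {(x, y) | y · ∏ᵢ (x − aᵢ) = 1} ⊂ 𝔸²`.
local notation3 (prettyPrint := false) "ZP " a:arg =>
  (⟨2, 1, ![X 1 * ∏ i, (X 0 - C (a i)) - 1]⟩ : CurveData)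

/-- **Huber–Wüstholz, Theorem 13.3 (2), for elliptic curves ISOGENOUS to a fixed non-CM curve,
arbitrary paths, together with genus `0` — PROVED.** Let `M` be a period pair with algebraic
invariants and without complex multiplication. Every vanishing `ℚ̄`-linear combination of period
symbols on the curves `E_L` — `L` any period pair with algebraic invariants admitting an isogeny
`[α] : E_L → E_M`, `z ↦ αz` (`α ≠ 0` algebraic, `αΛ_L ⊆ Λ_M`), a different `L` for every symbol
allowed — on `E_M`, on the punctured lines `Z_a`, on `𝔾ₘ` and on `𝔸¹`, all with ARBITRARY `C¹`
paths with algebraic end points, is a `ℚ̄`-linear combination of the elementary relations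
(R1)–(R5): transfer every `E_L`-symbol to `E_M` along the isogeny (`Ell.Isog.exists_transfer_symbol`,
functoriality), then `huberWustholzCurvePeriods_ellipticPaths_puncturedLine` for `M`
(unconditional). The relations between the periods of isogenous curves are thus induced by
functoriality, as Theorem 13.3 (2) asserts.
[cite: HuberWustholz2022, Thm. 13.3 (2) (p. 121), §13.2 (pp. 122–125), Ch. 15] -/
theorem huberWustholzCurvePeriods_of_isogenousEllipticPaths
    (M : PeriodPair) (hM₂ : IsAlgebraic ℚ M.g₂) (hM₃ : IsAlgebraic ℚ M.g₃) (hCM : ¬ M.HasCM)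
    (c : PeriodSymbol →₀ ℂ) (hc : ∀ s, IsAlgebraic ℚ (c s))
    (hsupp : ∀ s ∈ c.support,
      (∃ (L : PeriodPair) (α : ℂ), IsAlgebraic ℚ L.g₂ ∧ IsAlgebraic ℚ L.g₃ ∧ α ≠ 0 ∧
        IsAlgebraic ℚ α ∧ (∀ l ∈ L.lattice, α * l ∈ M.lattice) ∧ s.Z = Ell.curve L) ∨
      (∃ (r : ℕ) (a : Fin r → ℂ), Function.Injective a ∧ (∀ i, IsAlgebraic ℚ (a i)) ∧
        s.Z = ZP a) ∨
      s.Z = Ell.curve M ∨ s.Z = (⟨2, 1, ![X 0 * X 1 - 1]⟩ : CurveData) ∨ s.Z = CurveData.affineLine)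
    (h0 : evalCombination c = 0) :
    ∃ (k : ℕ) (ρ : Fin k → (PeriodSymbol →₀ ℂ)) (a : Fin k → ℂ),
      (∀ l, IsElementaryRelation (ρ l)) ∧ (∀ l, IsAlgebraic ℚ (a l)) ∧ c = ∑ l, a l • ρ l := by
  classical
  have key : ∀ s : PeriodSymbol, ∃ V : PeriodSymbol →₀ ℂ, s ∈ c.support →
      ((∀ t, IsAlgebraic ℚ (V t)) ∧ InSpan (Finsupp.single s 1 - V) ∧
        (∀ t ∈ V.support,
          (∃ (r : ℕ) (a : Fin r → ℂ), Function.Injective a ∧ (∀ i, IsAlgebraic ℚ (a i)) ∧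
            t.Z = ZP a) ∨
          t.Z = Ell.curve M ∨ t.Z = (⟨2, 1, ![X 0 * X 1 - 1]⟩ : CurveData) ∨
            t.Z = CurveData.affineLine)) := by
    intro s
    by_cases hs : s ∈ c.support
    · rcases hsupp s hs with ⟨L, α, hL₂, hL₃, hα0, hαalg, hαL, hsZ⟩ | hrest
      · obtain ⟨Z, hZ, ω, hω, γ⟩ := s
        dsimp only at hsZ
        subst hsZ
        obtain rfl : hZ = Ell.smooth L hL₂ hL₃ := rfl
        obtain ⟨S, hR⟩ := Ell.Isog.exists_reps hα0 hαalg hαL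
        obtain ⟨V, hValg, hVrel, hVsupp⟩ :=
          Ell.Isog.exists_transfer_symbol hR hL₂ hL₃ hM₂ hM₃ ω hω γ
        exact ⟨V, fun _ => ⟨hValg, hVrel, fun t ht => Or.inr (by
          rcases hVsupp t ht with ⟨h, -⟩ | h
          · exact Or.inl h
          · exact Or.inr (Or.inr h))⟩⟩
      · exact ⟨Finsupp.single s 1, fun _ => ⟨fun t => isAlgebraic_single_one_apply _ _,
          by rw [sub_self]; exact span_zero, fun t ht => by
            have h3 := (Finsupp.mem_support_single _ _ _).1 ht
            rw [h3.1]
            exact hrest⟩⟩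
    · exact ⟨0, fun h => (hs h).elim⟩
  choose V hV using key
  exact span_of_transfer_finsupp c hc V (fun s hs => (hV s hs).1) (fun s hs => (hV s hs).2.1)
    (fun t => (∃ (r : ℕ) (a : Fin r → ℂ), Function.Injective a ∧ (∀ i, IsAlgebraic ℚ (a i)) ∧
        t.Z = ZP a) ∨
      t.Z = Ell.curve M ∨ t.Z = (⟨2, 1, ![X 0 * X 1 - 1]⟩ : CurveData) ∨ t.Z = CurveData.affineLine)
    (fun s hs => (hV s hs).2.2)
    (fun c' hc' hsupp' h0' =>
      huberWustholzCurvePeriods_ellipticPaths_puncturedLine M hM₂ hM₃ hCM c' hc' hsupp' h0')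
    h0

/-- **Huber–Wüstholz, Theorem 13.3 (2), for CLOSED paths on elliptic curves isogenous to a fixed
elliptic curve `E_M` (with or without complex multiplication), together with closed paths on `𝔾ₘ`
and `𝔸¹` — PROVED**: transfer along the isogenies (`Ell.Isog.exists_transfer_symbol`; closed paths
go to closed paths since `α(z₁ − z₀) ∈ Λ_M`), then `huberWustholzCurvePeriods_ellipticLoops_all`
for `M` (`CurvePeriodsEllipticCMLoopsProofs.lean`).
[cite: HuberWustholz2022, Thm. 13.3 (2) (p. 121), §13.2 (pp. 122–125)] [cite: Masser1975, Ch. II Thm. II, Ch. III Thm. III] -/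
theorem huberWustholzCurvePeriods_of_isogenousEllipticLoops
    (M : PeriodPair) (hM₂ : IsAlgebraic ℚ M.g₂) (hM₃ : IsAlgebraic ℚ M.g₃)
    (c : PeriodSymbol →₀ ℂ) (hc : ∀ s, IsAlgebraic ℚ (c s))
    (hsupp : ∀ s ∈ c.support,
      (∃ (L : PeriodPair) (α : ℂ), IsAlgebraic ℚ L.g₂ ∧ IsAlgebraic ℚ L.g₃ ∧ α ≠ 0 ∧
        IsAlgebraic ℚ α ∧ (∀ l ∈ L.lattice, α * l ∈ M.lattice) ∧ s.Z = Ell.curve L ∧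
        s.γ.toFun 1 = s.γ.toFun 0) ∨
      (s.Z = Ell.curve M ∧ s.γ.toFun 1 = s.γ.toFun 0) ∨
      (s.Z = (⟨2, 1, ![X 0 * X 1 - 1]⟩ : CurveData) ∧ s.γ.toFun 1 = s.γ.toFun 0) ∨
      s.Z = CurveData.affineLine)
    (h0 : evalCombination c = 0) :
    ∃ (k : ℕ) (ρ : Fin k → (PeriodSymbol →₀ ℂ)) (a : Fin k → ℂ),
      (∀ l, IsElementaryRelation (ρ l)) ∧ (∀ l, IsAlgebraic ℚ (a l)) ∧ c = ∑ l, a l • ρ l := by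
  classical
  have key : ∀ s : PeriodSymbol, ∃ V : PeriodSymbol →₀ ℂ, s ∈ c.support →
      ((∀ t, IsAlgebraic ℚ (V t)) ∧ InSpan (Finsupp.single s 1 - V) ∧
        (∀ t ∈ V.support,
          (t.Z = Ell.curve M ∧ t.γ.toFun 1 = t.γ.toFun 0) ∨
          (t.Z = (⟨2, 1, ![X 0 * X 1 - 1]⟩ : CurveData) ∧ t.γ.toFun 1 = t.γ.toFun 0) ∨
            t.Z = CurveData.affineLine)) := by
    intro s
    by_cases hs : s ∈ c.support
    · rcases hsupp s hs with ⟨L, α, hL₂, hL₃, hα0, hαalg, hαL, hsZ, hcl⟩ | hrest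
      · obtain ⟨Z, hZ, ω, hω, γ⟩ := s
        dsimp only at hsZ hcl
        subst hsZ
        obtain rfl : hZ = Ell.smooth L hL₂ hL₃ := rfl
        obtain ⟨S, hR⟩ := Ell.Isog.exists_reps hα0 hαalg hαL
        obtain ⟨V, hValg, hVrel, hVsupp⟩ :=
          Ell.Isog.exists_transfer_symbol hR hL₂ hL₃ hM₂ hM₃ ω hω γ
        exact ⟨V, fun _ => ⟨hValg, hVrel, fun t ht => by
          rcases hVsupp t ht with ⟨h, h'⟩ | h
          · exact Or.inl ⟨h, h' hcl⟩
          · exact Or.inr (Or.inr h)⟩⟩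
      · exact ⟨Finsupp.single s 1, fun _ => ⟨fun t => isAlgebraic_single_one_apply _ _,
          by rw [sub_self]; exact span_zero, fun t ht => by
            have h3 := (Finsupp.mem_support_single _ _ _).1 ht
            rw [h3.1]
            exact hrest⟩⟩
    · exact ⟨0, fun h => (hs h).elim⟩
  choose V hV using key
  exact span_of_transfer_finsupp c hc V (fun s hs => (hV s hs).1) (fun s hs => (hV s hs).2.1)
    (fun t => (t.Z = Ell.curve M ∧ t.γ.toFun 1 = t.γ.toFun 0) ∨
      (t.Z = (⟨2, 1, ![X 0 * X 1 - 1]⟩ : CurveData) ∧ t.γ.toFun 1 = t.γ.toFun 0) ∨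
        t.Z = CurveData.affineLine)
    (fun s hs => (hV s hs).2.2)
    (fun c' hc' hsupp' h0' => huberWustholzCurvePeriods_ellipticLoops_all M hM₂ hM₃ c' hc' hsupp' h0')
    h0

end Main

end CurvePeriods

end Literature.NumberTheory.Transcendental

end
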